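import Mathlib
import Summits.NavierStokesRegularity.NavierStokesRegularity.Theorems.EulerZoomLiouvillePowerGaugeEulerLiouvilleSelfSimilarBernoulliSqueezeVortical
import HarnessLib

/-!
# «FAST VORTICAL CHANNELS SQUEEZE VOLUME TOO FAST» with no growth hypothesis — the ORBIT LEMMA «inside ⇒ good»
# (crux `EulerZoomLiouville.PowerGaugeEulerLiouville` = stmt-NavierStokesRegularity-19832, line `birth`, THE ONE STATEMENT; LEAD's RESIDUE-MEMO-19832-g12 target T3)

Route №10 `EulerZoomLiouville` (NavierStokesRegularity); width seat ns-ezl-w5 g2.  The dynamical heart of the seat's g0 vortical squeeze (p635086) and of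
the pinched squeeze (p642094), EXTRACTED as a lemma in which the only global input — that the backward orbit of the cut-off similarity flow stays inside the
ball where the cut-off field IS the profile field — is a HYPOTHESIS on a time interval `[0, t₁]` rather than a consequence of a growth bound.  On such an interval
the orbit is a true backward similarity orbit, so: `ℋ` is non-decreasing (CIV (3.31)), the orbit stays in the high set `{ℋ > h}`; the weighted vorticity solves a
linear ODE (Cauchy), the orbit stays VORTICAL; by a first-exit argument on «not closer to the origin than the start» it stays FAR, so the one-sided channel
`⟪z, γz + U z⟫ ≤ −c₁‖z‖²` applies all along and the orbit ESCAPES, `‖Y(s)‖ ≥ ‖y‖e^{c₁s}`.  No growth hypothesis of any kind.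

* **`Loc.backwardOrbit_good_of_inside`** — the lemma.  Consumers: `…SqueezeFree` (T3d: the exit set has small MEASURE, so «inside» holds for most of the blob).

HONEST LABEL: a tool for ONE dynamical sub-stratum of THE ONE STATEMENT.  WHAT THIS IS NOT: not NS, not E — 19832 is a crux CLASS on the MODEL lattice (E/NS strata)
and stays OPEN; NS regularity is NOT proved. [folklore; ConstantinIgnatovaVicol2026Putative §3.4.1 (3.21)–(3.22), §3.4.3 (3.30)–(3.33)]
-/

noncomputable section

-- flat `Theorems/<Route><Decl>…` files of one crux share the namespace of the crux (tree convention)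
set_option linter.dupNamespace false

open MeasureTheory Set Filter Topology Metric Function InnerProductSpace
open scoped RealInnerProductSpace NNReal ENNReal ContDiff

namespace Summit.NavierStokesRegularity.NavierStokesRegularity.Theorems.PowerGaugeEulerLiouville.Loc

open Literature.Analysis Literature.Analysis.FluidPDE
open Summit.NavierStokesRegularity.NavierStokesRegularity.Theorems.PowerGaugeEulerLiouville.BernoulliLandscape
open Summit.NavierStokesRegularity.NavierStokesRegularity.Theorems.PowerGaugeEulerLiouville.BackwardEscape
open Summit.NavierStokesRegularity.NavierStokesRegularity.Theorems.PowerGaugeEulerLiouville.NodalFiniteness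

variable {γ : ℝ} {U : EuclideanSpace ℝ (Fin 3) → EuclideanSpace ℝ (Fin 3)} {P : EuclideanSpace ℝ (Fin 3) → ℝ}

set_option maxHeartbeats 800000 in
/-- **THE ORBIT LEMMA «INSIDE ⇒ GOOD».**  `(U, P)` a `C²` CIV (3.3) profile, `γ ≤ ½`; `V` a `C¹` field with bounded derivative whose similarity transport field
`γz + V z` agrees with `γz + U z` on the ball `‖z‖ < R_b`; the one-sided channel `⟪z, γz + U z⟫ ≤ −c₁‖z‖²` (`c₁ > 0`) at every vortical point of `{ℋ > h}` with
`‖z‖ ≥ R₀`.  Let `y ≠ 0` be such a point (`‖y‖ ≥ R₀`, `ℋ(y) > h`, `curl U y ≠ 0`) and suppose the backward orbit `Y(s) = Φ_{−s} y` of the flow of `γz + V z` stays in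
`‖·‖ < R_b` for `s ∈ [0, t₁]`.  Then for every `s ∈ [0, t₁]`: `‖y‖e^{c₁s} ≤ ‖Y(s)‖`, `ℋ(Y(s)) > h`, `curl U (Y(s)) ≠ 0`, and the channel inequality holds at `Y(s)`.
[folklore; ConstantinIgnatovaVicol2026Putative §3.4] -/
theorem backwardOrbit_good_of_inside (hprof : IsSelfSimilarEulerProfile γ 0 U P) (hγ2 : γ ≤ 1 / 2)
    {V : EuclideanSpace ℝ (Fin 3) → EuclideanSpace ℝ (Fin 3)} (hV1 : ContDiff ℝ 1 V) {K : ℝ}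
    (hK : ∀ y : EuclideanSpace ℝ (Fin 3), ‖fderiv ℝ V y‖ ≤ K) {Rb : ℝ}
    (hWU : ∀ z : EuclideanSpace ℝ (Fin 3), ‖z‖ < Rb → selfSimilarTransport γ 0 V z = selfSimilarTransport γ 0 U z)
    {h R₀ c₁ : ℝ} (hc₁ : 0 < c₁)
    (hfastR : ∀ z : EuclideanSpace ℝ (Fin 3), R₀ ≤ ‖z‖ → h < selfSimilarBernoulli γ 0 U P z → curl U z ≠ 0 →
      ⟪z, selfSimilarTransport γ 0 U z⟫ ≤ -(c₁ * ‖z‖ ^ 2))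
    {y : EuclideanSpace ℝ (Fin 3)} (hyR₀ : R₀ ≤ ‖y‖) (hy0 : 0 < ‖y‖) (hyh : h < selfSimilarBernoulli γ 0 U P y)
    (hyc : curl U y ≠ 0) {t₁ : ℝ} (ht₁ : 0 ≤ t₁)
    (hinside : ∀ s ∈ Icc 0 t₁, ‖ODE.evolutionMap (fun _ : ℝ => selfSimilarTransport γ 0 V) 0 (-s) y‖ < Rb) :
    ∀ s ∈ Icc 0 t₁,
      ‖y‖ * Real.exp (c₁ * s) ≤ ‖ODE.evolutionMap (fun _ : ℝ => selfSimilarTransport γ 0 V) 0 (-s) y‖ ∧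
      h < selfSimilarBernoulli γ 0 U P (ODE.evolutionMap (fun _ : ℝ => selfSimilarTransport γ 0 V) 0 (-s) y) ∧
      curl U (ODE.evolutionMap (fun _ : ℝ => selfSimilarTransport γ 0 V) 0 (-s) y) ≠ 0 ∧
      ⟪ODE.evolutionMap (fun _ : ℝ => selfSimilarTransport γ 0 V) 0 (-s) y,
        selfSimilarTransport γ 0 V (ODE.evolutionMap (fun _ : ℝ => selfSimilarTransport γ 0 V) 0 (-s) y)⟫ ≤
        -(c₁ * ‖ODE.evolutionMap (fun _ : ℝ => selfSimilarTransport γ 0 V) 0 (-s) y‖ ^ 2) := by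
  -- adapted from `Loc.curl_eq_zero_of_vorticalFastChannel_of_thin` (…SelfSimilarBernoulliSqueezeVortical, ns-ezl-w5 g0)
  set Hb : EuclideanSpace ℝ (Fin 3) → ℝ := selfSimilarBernoulli γ 0 U P with hHb
  set Φ : ℝ → EuclideanSpace ℝ (Fin 3) → EuclideanSpace ℝ (Fin 3) :=
    ODE.evolutionMap (fun _ : ℝ => selfSimilarTransport γ 0 V) 0 with hΦ
  have hY : ∀ t, HasDerivAt (fun r => Φ (-r) y) ((-1 : ℝ) • selfSimilarTransport γ 0 V (Φ (-t) y)) t :=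
    fun t => C2.Kelvin.hasDerivAt_flow_neg (γ := γ) hV1 hK y t
  set Y : ℝ → EuclideanSpace ℝ (Fin 3) := fun t => Φ (-t) y with hYdef
  have hY0 : Y 0 = y := by simp [hYdef, hΦ, ODE.evolutionMap_self]
  have hYc : Continuous Y := continuous_iff_continuousAt.2 fun t => (hY t).continuousAt
  -- (i) what `good t` (the orbit has not come closer than `‖y‖` on `[0,t]`) buys, for `t ≤ t₁`
  have hgood : ∀ t, 0 ≤ t → t ≤ t₁ → (∀ s ∈ Icc 0 t, ‖y‖ ≤ ‖Y s‖) →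
      ∀ s ∈ Icc 0 t, ‖y‖ * Real.exp (c₁ * s) ≤ ‖Y s‖ ∧ h < Hb (Y s) ∧ curl U (Y s) ≠ 0 ∧
        ⟪Y s, selfSimilarTransport γ 0 V (Y s)⟫ ≤ -(c₁ * ‖Y s‖ ^ 2) := by
    intro t ht0 htT hg
    have hin : ∀ s ∈ Icc 0 t, ‖Y s‖ < Rb := fun s hs => hinside s ⟨hs.1, hs.2.trans htT⟩
    have hYU : ∀ s ∈ Icc 0 t, HasDerivAt Y ((-1 : ℝ) • selfSimilarTransport γ 0 U (Y s)) s := by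
      intro s hs
      have h1 := hY s
      rw [hWU _ (hin s hs)] at h1
      exact h1
    -- `ℋ` is non-decreasing along the (true) backward orbit: the orbit stays in `Θ_h`
    have hH : ∀ s ∈ Icc 0 t, h < Hb (Y s) := by
      intro s hs
      have h1 := selfSimilarBernoulli_monotone_backward hprof hγ2 hs.1
        (fun σ hσ => hYU σ ⟨hσ.1, hσ.2.trans hs.2⟩)
      rw [hY0] at h1
      exact lt_of_lt_of_le hyh h1
    -- the orbit stays VORTICAL: the weighted vorticity solves a linear ODE along the true orbit
    have hvort : ∀ s ∈ Icc 0 t, curl U (Y s) ≠ 0 := by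
      intro s₁ hs₁ hzero
      set Acl : ℝ → EuclideanSpace ℝ (Fin 3) →L[ℝ] EuclideanSpace ℝ (Fin 3) :=
        fun σ => (-1 : ℝ) • fderiv ℝ (selfSimilarTransport γ 0 U) (Y σ) with hAcl
      set w : ℝ → EuclideanSpace ℝ (Fin 3) := fun σ => Real.exp ((-1 : ℝ) * (1 + γ) * σ) • curl U (Y σ) with hw
      have hw' : ∀ σ ∈ Icc 0 s₁, HasDerivAt w (Acl σ (w σ)) σ := fun σ hσ =>
        hasDerivAt_weightedCurl_comp hprof (hYU σ ⟨hσ.1, hσ.2.trans hs₁.2⟩)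
      have hAc : Continuous fun σ => Acl σ := by
        have h1 : Continuous fun σ => fderiv ℝ (selfSimilarTransport γ 0 U) (Y σ) :=
          (continuous_fderiv_transport hprof).comp hYc
        exact h1.const_smul (-1 : ℝ)
      obtain ⟨Kb, hKb⟩ := (isCompact_Icc (a := (0 : ℝ)) (b := s₁)).exists_bound_of_continuousOn hAc.continuousOn
      have hKV : ∀ σ ∈ Icc 0 s₁, LipschitzOnWith (Real.toNNReal Kb)
          (fun z : EuclideanSpace ℝ (Fin 3) => Acl σ z) univ := by
        intro σ hσ
        refine ((Acl σ).lipschitz.weaken ?_).lipschitzOnWith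
        rw [← NNReal.coe_le_coe, coe_nnnorm, Real.coe_toNNReal _ ((norm_nonneg _).trans (hKb σ hσ))]
        exact hKb σ hσ
      have hwc : ContinuousOn w (Icc 0 s₁) := fun σ hσ => (hw' σ hσ).continuousAt.continuousWithinAt
      have hws₁ : w s₁ = 0 := by simp [hw, hzero]
      have hEq : EqOn w (fun _ => (0 : EuclideanSpace ℝ (Fin 3))) (Icc 0 s₁) :=
        ODE_solution_unique_of_mem_Icc_left (v := fun σ z => Acl σ z) (s := fun _ => univ)
          (fun σ hσ => hKV σ (Ioc_subset_Icc_self hσ)) hwc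
          (fun σ hσ => (hw' σ (Ioc_subset_Icc_self hσ)).hasDerivWithinAt) (fun _ _ => mem_univ _)
          continuousOn_const
          (fun σ _ => by
            have h0 : HasDerivWithinAt (fun _ : ℝ => (0 : EuclideanSpace ℝ (Fin 3))) 0 (Iic σ) σ :=
              hasDerivWithinAt_const _ _ _
            simpa using h0)
          (fun _ _ => mem_univ _) (by simpa using hws₁)
      have hw0 : w 0 = 0 := hEq ⟨le_rfl, hs₁.1⟩
      have : curl U y = 0 := by simpa [hw, hY0] using hw0
      exact hyc this
    -- the channel applies, and the orbit escapes
    have hch : ∀ s ∈ Icc 0 t, ⟪Y s, selfSimilarTransport γ 0 V (Y s)⟫ ≤ -(c₁ * ‖Y s‖ ^ 2) := by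
      intro s hs
      rw [hWU _ (hin s hs)]
      exact hfastR (Y s) (hyR₀.trans (hg s hs)) (hH s hs) (hvort s hs)
    have hlow : ∀ s ∈ Icc 0 t, ‖y‖ * Real.exp (c₁ * s) ≤ ‖Y s‖ := by
      intro s hs
      have h1 := norm_ge_mul_exp_of_fastInflow (γ := γ) (V := V) (Y := Y) ht0 (fun σ _ => hY σ) hch s hs
      simpa [hY0] using h1
    exact fun s hs => ⟨hlow s hs, hH s hs, hvort s hs, hch s hs⟩
  -- (ii) `good t₁` by a first-exit argument
  have hgoodT : ∀ s ∈ Icc 0 t₁, ‖y‖ ≤ ‖Y s‖ := by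
    by_contra hbad
    push Not at hbad
    set B : Set ℝ := {s | s ∈ Icc 0 t₁ ∧ ‖Y s‖ < ‖y‖} with hB
    have hBne : B.Nonempty := by obtain ⟨s, hs, hlt⟩ := hbad; exact ⟨s, hs, hlt⟩
    have hBbdd : BddBelow B := ⟨0, fun s hs => hs.1.1⟩
    set t₀ : ℝ := sInf B with ht₀
    have ht₀mem : ∀ s ∈ B, t₀ ≤ s := fun s hs => csInf_le hBbdd hs
    have ht₀0 : 0 ≤ t₀ := le_csInf hBne fun s hs => hs.1.1
    have ht₀T : t₀ ≤ t₁ := by obtain ⟨s, hs⟩ := hBne; exact (ht₀mem s hs).trans hs.1.2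
    -- before `t₀` the orbit is good
    have hbefore : ∀ s ∈ Icc 0 t₁, s < t₀ → ‖y‖ ≤ ‖Y s‖ := by
      intro s hs hst
      by_contra hlt
      exact absurd (ht₀mem s ⟨hs, not_le.1 hlt⟩) (not_le.2 hst)
    -- hence also at `t₀` (continuity), so `good t₀`
    have hgood₀ : ∀ s ∈ Icc 0 t₀, ‖y‖ ≤ ‖Y s‖ := by
      intro s hs
      rcases eq_or_lt_of_le hs.2 with heq | hlt
      · rw [heq]
        rcases eq_or_lt_of_le ht₀0 with h00 | h0pos
        · rw [← h00, hY0]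
        · have hcl : ‖Y t₀‖ ∈ closure ((fun σ => ‖Y σ‖) '' Ico 0 t₀) := by
            have hct : ContinuousWithinAt (fun σ => ‖Y σ‖) (Ico 0 t₀) t₀ :=
              (hYc.norm.continuousAt).continuousWithinAt
            have hmem : t₀ ∈ closure (Ico 0 t₀) := by
              rw [closure_Ico h0pos.ne]; exact right_mem_Icc.2 ht₀0
            exact hct.mem_closure_image hmem
          have hsub : (fun σ => ‖Y σ‖) '' Ico 0 t₀ ⊆ Ici ‖y‖ := by
            rintro _ ⟨σ, hσ, rfl⟩
            exact hbefore σ ⟨hσ.1, hσ.2.le.trans ht₀T⟩ hσ.2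
          exact closure_mono hsub hcl |> fun hx => by rwa [closure_Ici, mem_Ici] at hx
      · exact hbefore s ⟨hs.1, hlt.le.trans ht₀T⟩ hlt
    obtain ⟨hlow₀, -, -, hch₀⟩ := hgood t₀ ht₀0 ht₀T hgood₀ t₀ ⟨ht₀0, le_rfl⟩
    -- the strict channel inequality at `t₀` persists a little beyond `t₀`
    have hYt₀pos : 0 < ‖Y t₀‖ := lt_of_lt_of_le hy0 (hgood₀ t₀ ⟨ht₀0, le_rfl⟩)
    have hcont : Continuous fun σ => ⟪Y σ, selfSimilarTransport γ 0 V (Y σ)⟫ + c₁ / 2 * ‖Y σ‖ ^ 2 := by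
      have hWc : Continuous (selfSimilarTransport γ 0 V) :=
        (PowerGaugeEulerLiouville.Kelvin.contDiff_selfSimilarTransport (γ := γ) hV1).continuous
      exact (hYc.inner (hWc.comp hYc)).add (continuous_const.mul (hYc.norm.pow 2))
    have hneg : ⟪Y t₀, selfSimilarTransport γ 0 V (Y t₀)⟫ + c₁ / 2 * ‖Y t₀‖ ^ 2 < 0 := by
      have : 0 < c₁ / 2 * ‖Y t₀‖ ^ 2 := by positivity
      linarith
    obtain ⟨δ, hδ, hδball⟩ := Metric.continuousAt_iff.1 hcont.continuousAt
      (-(⟪Y t₀, selfSimilarTransport γ 0 V (Y t₀)⟫ + c₁ / 2 * ‖Y t₀‖ ^ 2)) (by linarith)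
    have hch' : ∀ σ ∈ Icc t₀ (t₀ + δ / 2), ⟪Y σ, selfSimilarTransport γ 0 V (Y σ)⟫ ≤ -(c₁ / 2 * ‖Y σ‖ ^ 2) := by
      intro σ hσ
      have hd : dist σ t₀ < δ := by
        rw [Real.dist_eq, abs_of_nonneg (by linarith [hσ.1])]; linarith [hσ.2]
      have h1 := hδball hd
      rw [Real.dist_eq, abs_lt] at h1
      linarith [h1.2]
    have hesc : ∀ σ ∈ Icc t₀ (t₀ + δ / 2), ‖Y t₀‖ ≤ ‖Y σ‖ := by
      intro σ hσ
      have h1 := norm_ge_mul_exp_of_fastInflow (γ := γ) (V := V) (Y := Y) (c₁ := c₁ / 2) (by linarith : t₀ ≤ t₀ + δ / 2)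
        (fun σ' _ => hY σ') hch' σ hσ
      have h2 : 1 ≤ Real.exp (c₁ / 2 * (σ - t₀)) := Real.one_le_exp (by nlinarith [hσ.1])
      nlinarith [norm_nonneg (Y t₀)]
    -- no bad time in `[t₀, t₀ + δ/2]`, none before `t₀`: contradiction with `t₀ = inf B`
    have hlb : ∀ s ∈ B, t₀ + δ / 2 ≤ s := by
      intro s hs
      by_contra hlt
      push Not at hlt
      have hst₀ : t₀ ≤ s := ht₀mem s hs
      have h1 : ‖y‖ ≤ ‖Y s‖ := (hgood₀ t₀ ⟨ht₀0, le_rfl⟩).trans (hesc s ⟨hst₀, hlt.le⟩)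
      exact absurd hs.2 (not_lt.2 h1)
    have : t₀ + δ / 2 ≤ t₀ := le_csInf hBne hlb
    linarith
  intro s hs
  exact hgood t₁ ht₁ le_rfl hgoodT s hs

end Summit.NavierStokesRegularity.NavierStokesRegularity.Theorems.PowerGaugeEulerLiouville.Loc

end
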